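import Literature.Analysis.FluidPDE.TaoClassGlobal
import Literature.Analysis.FluidPDE.ClassicalSolutionGlue
import Literature.Analysis.FluidPDE.NSUnconditionalUniquenessHolds
import Literature.Analysis.FluidPDE.NSFiniteEnergySmoothProofs
import Literature.Analysis.FluidPDE.NSLerayHopf
import HarnessLib

/-!
# Smooth finite-energy solutions on `ℝ³`: patching the closed slabs `[0, T]` to Fefferman's `[0, ∞)`

Analysis/FluidPDE support file (all results proved; no definitions, no named facts), the
whole-space counterpart of `Literature/Analysis/FunctionSpaces/TorusClassicalNSHorizonPatching.lean`
(flat torus). Fefferman's problem (A) asks for ONE pair `u, p ∈ C^∞(ℝ³ × [0,∞))` with bounded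
energy (7) `∫ |u(x,t)|² dx < C` for all `t ≥ 0`; Tao's Conjecture 1.3 (the [feff] formulation he
works with, Anal. PDE 6 (2013), §1) asks instead, for every `0 < T < ∞`, for a *smooth finite energy
solution* on the CLOSED slab `[0, T] × ℝ³` (`u, p` smooth on `[0,T] × ℝ³`,
`‖u‖_{L^∞_t L²_x([0,T] × ℝ³)} < ∞`, his (6)). The two are equivalent datum by datum, and this file
proves the non-trivial direction as a theorem of the tree:

* `IsClassicalNSSolutionOn.sub_pressure_apply_zero` — shifting the pressure by its value at the
  origin, `p(t,x) − p(t,0)`, keeps a classical solution (any time set, any space `E`);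
* `IsClassicalNSSolutionOn.pressure_sub_apply_zero_eq_of_eqOn` — two classical solutions whose
  velocities agree on a time set `S ⊆ S₁ ∩ S₂` of unique differentiability at `t` (boundary times
  such as `t = 0` included) have pressures differing by a function of time at `t` (from the tree's
  `IsClassicalNSSolutionOn.gradient_pressure_eq_of_eqOn`, `TaoClassGlue.lean`);
* `IsClassicalNSSolutionOn.eq_of_finiteEnergy` — **uniqueness on the common closed slab**: two
  smooth finite-energy solutions of the unforced system (`ν > 0`) on `[0, T₁] × ℝ³`, `[0, T₂] × ℝ³`
  from the same `H¹` datum agree at every common time — Tao 2013, Cor. 11.4 (arXiv Cor. 71), in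
  the tree as `tao_unconditional_uniqueness_velocity_holds` (PROVED);
* `IsClassicalNSSolutionOn.exists_Ici_of_forall_Icc_finiteEnergy` — **PATCHING**: if for every
  `T > 0` the unforced Cauchy problem (`ν > 0`, datum `u₀` with `∇u₀ ∈ L²`) has a smooth
  finite-energy solution on `[0, T] × ℝ³`, then it has a classical solution on `[0, ∞) × ℝ³`
  (jointly `C^∞` up to `t = 0`) with `u(0) = u₀`, pressure vanishing at the origin, and BOUNDED
  ENERGY `∫ |u(t)|² ≤ C ∫ |u₀|²` for all `t ≥ 0` — the uniform constant being Tao's global energy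
  inequality Lemma 8.1 (arXiv Lemma 44), in the tree as `tao_finite_energy_smooth_energy_bound_holds`
  (PROVED); the exhaustion `[0,∞) = ⋃ₙ [0, n+1)` is the tree's
  `IsClassicalNSSolutionOn.of_forall_Ico_nat` (`TaoClassGlobal.lean`);
* `IsClassicalNSSolutionOn.exists_Ici_boundedEnergy_iff_forall_Icc`,
  `…_iff_forall_Ico` — the equivalences «one smooth bounded-energy solution on `[0, ∞)`» ⇔ «a
  smooth finite-energy solution on `[0, T]` (resp. `[0, T)`) for every `T > 0`»;
* `IsClassicalNSSolutionOn.exists_Ici_of_forall_Icc_of_unique` — the GENERIC patching lemma behind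
  all of the above (any space `E`, any force `f`, any `ν`): slab solutions on every `[0, T]` in a
  class `Q` that determines the velocity (uniqueness across horizons given as a HYPOTHESIS) patch to a
  classical solution on `[0, ∞)`, every finite piece of which IS one of the given slab solutions
  (velocity verbatim, pressure up to its value at the origin) — so slice-wise side conditions of the
  class transfer. This is the kernel form of the «pure bookkeeping» deltas `ClayDelta` of per-horizon
  claims (e.g. `Literature.Claims.NS.Ruzmaikina2008.ClayDelta`).

What is NOT here (and not in print): uniqueness, hence patching, for smooth solutions on
`[0, T] × ℝ³` WITHOUT the finite-energy condition (6)/(7), or from data that are not `H¹`; Tao's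
theory (Cor. 11.4) needs both. Consumed by `Literature/Claims/NS/ClayR3HorizonBridge.lean` (the Clay
(A)/(C) reference of the D-0090 claims map, axis Δ7 horizon).

## Mathlib / tree search

Tree (`lean search 'gradient_pressure_eq_of_eqOn|of_forall_Ico_nat|congr_slices|sub_apply_zero'`):
`IsClassicalNSSolutionOn.gradient_pressure_eq_of_eqOn` (`TaoClassGlue`), `….congr_slices`,
`….of_forall_Ico_nat` (`TaoClassGlobal`), `IsSmoothSpaceTimeOn.sub_apply_zero`, `gradient_sub_const`,
`….pressure_sub_apply_zero_eq_of_eventuallyEq` (interior times only; `ClassicalSolutionGlue`),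
`tao_unconditional_uniqueness_velocity_holds`, `tao_finite_energy_smooth_energy_bound_holds`,
`isNavierStokesSolution_and_smooth_iff` (`NSLerayHopf`); the torus file has the same architecture
with Majda–Bertozzi uniqueness. Mathlib: `is_const_of_fderiv_eq_zero`, `Nat.lt_floor_add_one`,
`ENNReal.mul_lt_top`, `gcongr`.

## References

* T. Tao, *Localisation and compactness properties of the Navier–Stokes global regularity
  problem*, Anal. PDE 6 (2013) 25–107 = arXiv:1108.1165: §1 (Def. 1.1, (6), footnote 2; Rem. 1.2;
  Conj. 1.3), Lemma 8.1 (arXiv Lemma 44), Cor. 11.4 (arXiv Cor. 71). [Tao2011] [Tao2013Localisation]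
* C. L. Fefferman, *Existence and smoothness of the Navier–Stokes equation*, CMI 2006, (A) with
  (4), (6), (7), p. 2. [FeffermanClay2006]
* J. C. Robinson, J. L. Rodrigo, W. Sadowski, *The Three-Dimensional Navier–Stokes Equations.
  Classical Theory*, CUP 2016, §8.1. [RobinsonRodrigoSadowskiCUP2016]
* P. G. Lemarié-Rieusset, *The Navier–Stokes Problem in the 21st Century*, CRC 2016, Thm. 7.2
  (proof, p. 147: the maximal time is `+∞`). [LemarieRieusset2016]

WHAT THIS IS NOT: not a claim about NS regularity or blow-up; not a claim about any author beyond
the typed locator.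
-/

noncomputable section

open MeasureTheory Set Function Filter Topology
open scoped ENNReal NNReal ContDiff

namespace Literature.Analysis.FluidPDE

/-! ## Bookkeeping on an arbitrary space `E` -/

section General

variable {E : Type*} [NormedAddCommGroup E] [InnerProductSpace ℝ E] [FiniteDimensional ℝ E]
variable {S : Set ℝ} {ν : ℝ} {f : ℝ → E → E}

/-- **Normalising the pressure at the origin.** If `(u, p)` is a classical solution on the time set
`S`, so is `(u, p − p(·, 0))`: the pressure enters the equations through `∇p` only
(`gradient_sub_const`), and `(t, x) ↦ p(t, x) − p(t, 0)` is jointly smooth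
(`IsSmoothSpaceTimeOn.sub_apply_zero`) — Tao's pressure-shift symmetry (32). [cite: Tao2011, §2 eq. (32) (arXiv (const))] -/
theorem IsClassicalNSSolutionOn.sub_pressure_apply_zero {u : ℝ → E → E} {p : ℝ → E → ℝ}
    (h : IsClassicalNSSolutionOn S ν f u p) :
    IsClassicalNSSolutionOn S ν f u (fun t x => p t x - p t 0) where
  smooth_velocity := h.smooth_velocity
  smooth_pressure := h.smooth_pressure.sub_apply_zero
  momentum t ht x := by
    have hm := h.momentum t ht x
    rwa [← gradient_sub_const (p t) (p t 0) x] at hm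
  divFree := h.divFree

/-- **Pressures with the same velocity differ by a function of time — boundary-capable version.**
Let `(u₁, p₁)`, `(u₂, p₂)` be classical solutions (same `ν`, same force) on time sets `S₁ ⊇ S`,
`S₂ ⊇ S`, with `u₁ = u₂` on `S`, and let `S` have unique differentiability at `t ∈ S` (e.g.
`S = [0, m]`, `t = 0` allowed). Then `p₁(t, x) − p₁(t, 0) = p₂(t, x) − p₂(t, 0)`: the gradients
agree (`gradient_pressure_eq_of_eqOn`) and a `C¹` function with zero derivative is constant
(Mathlib `is_const_of_fderiv_eq_zero`); the identification step of every restart argument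
(Robinson–Rodrigo–Sadowski 2016, §8.1; Tao's pressure-shift symmetry (32)). [cite: RobinsonRodrigoSadowskiCUP2016, §8.1] -/
theorem IsClassicalNSSolutionOn.pressure_sub_apply_zero_eq_of_eqOn {S₁ S₂ : Set ℝ}
    {u₁ u₂ : ℝ → E → E} {p₁ p₂ : ℝ → E → ℝ}
    (h₁ : IsClassicalNSSolutionOn S₁ ν f u₁ p₁) (h₂ : IsClassicalNSSolutionOn S₂ ν f u₂ p₂)
    (hS₁ : S ⊆ S₁) (hS₂ : S ⊆ S₂) {t : ℝ} (ht : t ∈ S) (hU : UniqueDiffWithinAt ℝ S t)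
    (heq : ∀ s ∈ S, u₁ s = u₂ s) (x : E) :
    p₁ t x - p₁ t 0 = p₂ t x - p₂ t 0 := by
  have hd₁ : Differentiable ℝ (p₁ t) :=
    (h₁.contDiff_pressure (hS₁ ht)).differentiable (by simp)
  have hd₂ : Differentiable ℝ (p₂ t) :=
    (h₂.contDiff_pressure (hS₂ ht)).differentiable (by simp)
  have hdiff : Differentiable ℝ (fun y => p₁ t y - p₂ t y) := hd₁.sub hd₂
  have hzero : ∀ y, fderiv ℝ (fun y => p₁ t y - p₂ t y) y = 0 := by
    intro y
    rw [fderiv_fun_sub (hd₁ y) (hd₂ y)]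
    have hg := h₁.gradient_pressure_eq_of_eqOn h₂ hS₁ hS₂ ht hU heq y
    unfold gradient at hg
    rw [(InnerProductSpace.toDual ℝ E).symm.injective hg, sub_self]
  have hc := is_const_of_fderiv_eq_zero hdiff hzero x 0
  linarith

end General

/-! ## `ℝ³`: uniqueness on the common slab and patching, for smooth finite-energy solutions -/

section R3

variable {ν : ℝ} {u₀ : EuclideanSpace ℝ (Fin 3) → EuclideanSpace ℝ (Fin 3)}

/-- **Uniqueness of smooth finite-energy solutions on the common closed slab** (Tao 2013,
Cor. 11.4, velocity form, in the tree as the theorem `tao_unconditional_uniqueness_velocity_holds`).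
Let `ν > 0` and let `u₀` have `∇u₀ ∈ L²`. If `(u₁, p₁)` and `(u₂, p₂)` are classical solutions of
the unforced system on `[0, T₁] × ℝ³` and `[0, T₂] × ℝ³` (jointly smooth on the closed slabs) with
`u₁(0) = u₂(0) = u₀` and finite energy `sup_{[0,Tᵢ]} ∫ |uᵢ|² < ∞`, then `u₁(t) = u₂(t)` for
`0 ≤ t ≤ min T₁ T₂` (restrict both to `[0, t]`; `u₀ ∈ L²` is read off the energy bound at `t = 0`
and the smoothness of the slice `u₁ 0`). [cite: Tao2011, Cor. 11.4 (arXiv Cor. 71)] -/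
theorem IsClassicalNSSolutionOn.eq_of_finiteEnergy (hν : 0 < ν) (hH1 : MemLp (fderiv ℝ u₀) 2 volume)
    {T₁ T₂ : ℝ} {u₁ u₂ : ℝ → EuclideanSpace ℝ (Fin 3) → EuclideanSpace ℝ (Fin 3)} {p₁ p₂ : ℝ → EuclideanSpace ℝ (Fin 3) → ℝ}
    (h₁ : IsClassicalNSSolutionOn (Icc 0 T₁) ν 0 u₁ p₁)
    (h₂ : IsClassicalNSSolutionOn (Icc 0 T₂) ν 0 u₂ p₂) (h0₁ : u₁ 0 = u₀) (h0₂ : u₂ 0 = u₀)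
    (hE₁ : ∃ A : ℝ≥0∞, A < ⊤ ∧ ∀ t ∈ Icc 0 T₁, ∫⁻ x, ‖u₁ t x‖ₑ ^ 2 ≤ A)
    (hE₂ : ∃ A : ℝ≥0∞, A < ⊤ ∧ ∀ t ∈ Icc 0 T₂, ∫⁻ x, ‖u₂ t x‖ₑ ^ 2 ≤ A)
    {t : ℝ} (ht₁ : t ∈ Icc 0 T₁) (ht₂ : t ≤ T₂) : u₁ t = u₂ t := by
  rcases ht₁.1.eq_or_lt with h00 | ht0
  · subst h00
    rw [h0₁, h0₂]
  · have h0T₁ : (0 : ℝ) ∈ Icc 0 T₁ := ⟨le_rfl, ht₁.1.trans ht₁.2⟩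
    -- the datum is in `L²`: finite energy at `t = 0`, measurability from smoothness of the slice
    have hL2 : MemLp u₀ 2 volume := by
      obtain ⟨A, hA, hb⟩ := hE₁
      have hlt : ∫⁻ x, ‖u₀ x‖ₑ ^ 2 < ⊤ := by
        rw [← h0₁]
        exact (hb 0 h0T₁).trans_lt hA
      have hc : ContDiff ℝ ∞ u₀ := by
        rw [← h0₁]
        exact h₁.contDiff_velocity h0T₁
      exact ⟨hc.continuous.aestronglyMeasurable, eLpNorm_two_lt_top_of_lintegral_enorm_sq_lt_top hlt⟩
    have h₁' : IsClassicalNSSolutionOn (Icc 0 t) ν 0 u₁ p₁ :=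
      h₁.mono (Icc_subset_Icc_right ht₁.2) (uniqueDiffOn_Icc ht0)
    have h₂' : IsClassicalNSSolutionOn (Icc 0 t) ν 0 u₂ p₂ :=
      h₂.mono (Icc_subset_Icc_right ht₂) (uniqueDiffOn_Icc ht0)
    have hE₁' : ∃ A : ℝ≥0∞, A < ⊤ ∧ ∀ s ∈ Icc 0 t, ∫⁻ x, ‖u₁ s x‖ₑ ^ 2 ≤ A := by
      obtain ⟨A, hA, hb⟩ := hE₁
      exact ⟨A, hA, fun s hs => hb s ⟨hs.1, hs.2.trans ht₁.2⟩⟩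
    have hE₂' : ∃ A : ℝ≥0∞, A < ⊤ ∧ ∀ s ∈ Icc 0 t, ∫⁻ x, ‖u₂ s x‖ₑ ^ 2 ≤ A := by
      obtain ⟨A, hA, hb⟩ := hE₂
      exact ⟨A, hA, fun s hs => hb s ⟨hs.1, hs.2.trans ht₂⟩⟩
    exact tao_unconditional_uniqueness_velocity_holds ν t hν ht0 u₀ hL2 hH1 u₁ u₂ p₁ p₂ h₁' h₂'
      h0₁ h0₂ hE₁' hE₂' t ⟨ht0.le, le_rfl⟩

/-- **Patching the closed slabs `[0, T]` to `[0, ∞)` — smooth finite-energy solutions on `ℝ³`.**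
Let `ν > 0` and let the datum `u₀` have `∇u₀ ∈ L²`. If for every `T > 0` the unforced Cauchy
problem has a classical solution on `[0, T] × ℝ³` (jointly smooth on the closed slab) with
`u(0) = u₀` and finite energy `sup_{[0,T]} ∫ |u|² < ∞` — Tao's «smooth finite energy solution»,
Def. 1.1 with (6) — then it has a classical solution on `[0, ∞) × ℝ³` with `u(0) = u₀`, pressure
vanishing at the origin, and bounded energy on `[0, ∞)` (Fefferman's (7)). Proof: choose
`(Uₙ, Pₙ)` with horizon `n + 1`; any two agree at common times (`eq_of_finiteEnergy`, Tao Cor. 11.4);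
put `u(t) = U_{⌊t⌋₊}(t)`, `p(t,x) = P_{⌊t⌋₊}(t,x) − P_{⌊t⌋₊}(t,0)`; on `[0, N+1)` this pair IS
`(U_N, P_N − P_N(·,0))` slice by slice (`pressure_sub_apply_zero_eq_of_eqOn` on
`[0, min(⌊t⌋₊+1, N+1)]`), hence classical there (`sub_pressure_apply_zero`, `congr_slices`) and on
`[0, ∞)` (`of_forall_Ico_nat`); the energy bound, uniform in the horizon, is Tao's Lemma 8.1
`sup_t ∫|Uₙ(t)|² ≤ C ∫|u₀|²` (`tao_finite_energy_smooth_energy_bound_holds`). The last sentence of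
every «local existence + continuation ⇒ global» argument, written for the Clay class.
[cite: Tao2011, Lemma 8.1 (arXiv Lemma 44) and Cor. 11.4 (arXiv Cor. 71)] -/
theorem IsClassicalNSSolutionOn.exists_Ici_of_forall_Icc_finiteEnergy (hν : 0 < ν)
    (hH1 : MemLp (fderiv ℝ u₀) 2 volume)
    (h : ∀ T : ℝ, 0 < T →
      ∃ (u : ℝ → EuclideanSpace ℝ (Fin 3) → EuclideanSpace ℝ (Fin 3)) (p : ℝ → EuclideanSpace ℝ (Fin 3) → ℝ),
        IsClassicalNSSolutionOn (Icc 0 T) ν 0 u p ∧ u 0 = u₀ ∧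
          ∃ A : ℝ≥0∞, A < ⊤ ∧ ∀ t ∈ Icc 0 T, ∫⁻ x, ‖u t x‖ₑ ^ 2 ≤ A) :
    ∃ (u : ℝ → EuclideanSpace ℝ (Fin 3) → EuclideanSpace ℝ (Fin 3)) (p : ℝ → EuclideanSpace ℝ (Fin 3) → ℝ),
      IsClassicalNSSolutionOn (Ici 0) ν 0 u p ∧ u 0 = u₀ ∧ HasBoundedEnergy u ∧
        ∀ t, p t 0 = 0 := by
  classical
  have hn : ∀ n : ℕ, ∃ (u : ℝ → EuclideanSpace ℝ (Fin 3) → EuclideanSpace ℝ (Fin 3)) (p : ℝ → EuclideanSpace ℝ (Fin 3) → ℝ),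
      IsClassicalNSSolutionOn (Icc 0 ((n : ℝ) + 1)) ν 0 u p ∧ u 0 = u₀ ∧
        ∃ A : ℝ≥0∞, A < ⊤ ∧ ∀ t ∈ Icc 0 ((n : ℝ) + 1), ∫⁻ x, ‖u t x‖ₑ ^ 2 ≤ A :=
    fun n => h _ (by positivity)
  choose U P hU hU0 hE using hn
  -- any two choices agree at common times
  have hagree : ∀ m n : ℕ, ∀ t ∈ Icc (0 : ℝ) ((m : ℝ) + 1), t ≤ (n : ℝ) + 1 → U m t = U n t :=
    fun m n t ht htn =>
      (hU m).eq_of_finiteEnergy hν hH1 (hU n) (hU0 m) (hU0 n) (hE m) (hE n) ht htn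
  -- the horizon used at time `t` is `⌊t⌋₊ + 1`
  have hmem : ∀ t : ℝ, 0 ≤ t → t ∈ Icc (0 : ℝ) ((⌊t⌋₊ : ℝ) + 1) := fun t ht =>
    ⟨ht, (Nat.lt_floor_add_one t).le⟩
  refine ⟨fun t => U ⌊t⌋₊ t, fun t x => P ⌊t⌋₊ t x - P ⌊t⌋₊ t 0, ?_, ?_, ?_, fun t => sub_self _⟩
  · refine IsClassicalNSSolutionOn.of_forall_Ico_nat fun N => ?_
    have hN : IsClassicalNSSolutionOn (Ico 0 ((N : ℝ) + 1)) ν 0 (U N)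
        (fun t x => P N t x - P N t 0) :=
      ((hU N).mono Ico_subset_Icc_self (uniqueDiffOn_Ico 0 _)).sub_pressure_apply_zero
    refine hN.congr_slices (fun t ht => hagree ⌊t⌋₊ N t (hmem t ht.1) ht.2.le) fun t ht => ?_
    -- the normalised pressures agree at `t`, boundary time `t = 0` included
    have ht0 : (0 : ℝ) ≤ t := ht.1
    set m : ℝ := min ((⌊t⌋₊ : ℝ) + 1) ((N : ℝ) + 1) with hm
    have hm0 : 0 < m := lt_min (by positivity) (by positivity)
    have htm : t ∈ Icc 0 m := ⟨ht0, le_min (Nat.lt_floor_add_one t).le ht.2.le⟩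
    have hS₁ : Icc 0 m ⊆ Icc 0 ((⌊t⌋₊ : ℝ) + 1) := Icc_subset_Icc_right (min_le_left _ _)
    have hS₂ : Icc 0 m ⊆ Icc 0 ((N : ℝ) + 1) := Icc_subset_Icc_right (min_le_right _ _)
    have heq : ∀ s ∈ Icc 0 m, U ⌊t⌋₊ s = U N s := fun s hs =>
      hagree ⌊t⌋₊ N s (hS₁ hs) (hs.2.trans (min_le_right _ _))
    funext x
    exact (hU ⌊t⌋₊).pressure_sub_apply_zero_eq_of_eqOn (hU N) hS₁ hS₂ htm
      (uniqueDiffOn_Icc hm0 t htm) heq x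
  · show U ⌊(0 : ℝ)⌋₊ 0 = u₀
    rw [Nat.floor_zero]
    exact hU0 0
  · -- bounded energy on `[0, ∞)`: Tao's Lemma 8.1 on each slab, constant independent of the slab
    obtain ⟨C, hC, hTao⟩ := tao_finite_energy_smooth_energy_bound_holds
    obtain ⟨A₀, hA₀, hb₀⟩ := hE 0
    refine ⟨C * A₀, ENNReal.mul_lt_top hC hA₀, fun t ht => ?_⟩
    have hpos : (0 : ℝ) < (⌊t⌋₊ : ℝ) + 1 := by positivity
    have h1 := (hTao ν ((⌊t⌋₊ : ℝ) + 1) hν hpos (U ⌊t⌋₊) (P ⌊t⌋₊) (hU ⌊t⌋₊) (hE ⌊t⌋₊)).1 t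
      (hmem t ht)
    show ∫⁻ x, ‖U ⌊t⌋₊ t x‖ₑ ^ 2 ≤ C * A₀
    refine h1.trans ?_
    rw [hU0 ⌊t⌋₊, ← hU0 0]
    gcongr
    exact hb₀ 0 ⟨le_rfl, by positivity⟩

/-- **«One smooth bounded-energy solution on `[0, ∞)`» ⇔ «a smooth finite-energy solution on
`[0, T]` for every `T > 0`»** (`ℝ³`, unforced, `ν > 0`, datum with `∇u₀ ∈ L²`): patching
(`exists_Ici_of_forall_Icc_finiteEnergy`) and restriction (`mono`; the energy bound restricts).
Fefferman's class (A) per datum ⇔ Tao's Conjecture 1.3 class per datum (Tao 2013, Rem. 1.2: «In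
[feff], one considered smooth finite energy solutions associated to Schwartz data»).
[cite: Tao2011, §1 Def. 1.1 with (6), Rem. 1.2, Conj. 1.3; Cor. 11.4; Lemma 8.1] -/
theorem IsClassicalNSSolutionOn.exists_Ici_boundedEnergy_iff_forall_Icc (hν : 0 < ν)
    (hH1 : MemLp (fderiv ℝ u₀) 2 volume) :
    (∃ (u : ℝ → EuclideanSpace ℝ (Fin 3) → EuclideanSpace ℝ (Fin 3)) (p : ℝ → EuclideanSpace ℝ (Fin 3) → ℝ),
        IsClassicalNSSolutionOn (Ici 0) ν 0 u p ∧ u 0 = u₀ ∧ HasBoundedEnergy u) ↔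
      ∀ T : ℝ, 0 < T →
        ∃ (u : ℝ → EuclideanSpace ℝ (Fin 3) → EuclideanSpace ℝ (Fin 3)) (p : ℝ → EuclideanSpace ℝ (Fin 3) → ℝ),
          IsClassicalNSSolutionOn (Icc 0 T) ν 0 u p ∧ u 0 = u₀ ∧
            ∃ A : ℝ≥0∞, A < ⊤ ∧ ∀ t ∈ Icc 0 T, ∫⁻ x, ‖u t x‖ₑ ^ 2 ≤ A := by
  constructor
  · rintro ⟨u, p, hcl, h0, C, hC, hb⟩ T hT
    exact ⟨u, p, hcl.mono Icc_subset_Ici_self (uniqueDiffOn_Icc hT), h0, C, hC,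
      fun t ht => hb t ht.1⟩
  · intro h
    obtain ⟨u, p, hcl, h0, hE, -⟩ :=
      IsClassicalNSSolutionOn.exists_Ici_of_forall_Icc_finiteEnergy hν hH1 h
    exact ⟨u, p, hcl, h0, hE⟩

/-- **The same with half-open horizons `[0, T)`** (finite energy on `[0, T)`): a solution on
`[0, T + 1)` restricts to `[0, T]`, one on `[0, ∞)` to `[0, T)`. [cite: Tao2011, §1 Def. 1.1 with (6), Conj. 1.3; Cor. 11.4; Lemma 8.1] -/
theorem IsClassicalNSSolutionOn.exists_Ici_boundedEnergy_iff_forall_Ico (hν : 0 < ν)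
    (hH1 : MemLp (fderiv ℝ u₀) 2 volume) :
    (∃ (u : ℝ → EuclideanSpace ℝ (Fin 3) → EuclideanSpace ℝ (Fin 3)) (p : ℝ → EuclideanSpace ℝ (Fin 3) → ℝ),
        IsClassicalNSSolutionOn (Ici 0) ν 0 u p ∧ u 0 = u₀ ∧ HasBoundedEnergy u) ↔
      ∀ T : ℝ, 0 < T →
        ∃ (u : ℝ → EuclideanSpace ℝ (Fin 3) → EuclideanSpace ℝ (Fin 3)) (p : ℝ → EuclideanSpace ℝ (Fin 3) → ℝ),
          IsClassicalNSSolutionOn (Ico 0 T) ν 0 u p ∧ u 0 = u₀ ∧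
            ∃ A : ℝ≥0∞, A < ⊤ ∧ ∀ t ∈ Ico 0 T, ∫⁻ x, ‖u t x‖ₑ ^ 2 ≤ A := by
  constructor
  · rintro ⟨u, p, hcl, h0, C, hC, hb⟩ T _
    exact ⟨u, p, hcl.mono Ico_subset_Ici_self (uniqueDiffOn_Ico 0 T), h0, C, hC,
      fun t ht => hb t ht.1⟩
  · intro h
    refine (IsClassicalNSSolutionOn.exists_Ici_boundedEnergy_iff_forall_Icc hν hH1).2 fun T hT => ?_
    obtain ⟨u, p, hcl, h0, A, hA, hb⟩ := h (T + 1) (by linarith)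
    have hsub : Icc 0 T ⊆ Ico 0 (T + 1) := Icc_subset_Ico_right (by linarith)
    exact ⟨u, p, hcl.mono hsub (uniqueDiffOn_Icc hT), h0, A, hA, fun t ht => hb t (hsub ht)⟩

end R3

/-! ## Generic patching: uniqueness across horizons as a hypothesis (any `E`, any force) -/

section Generic

variable {E : Type*} [NormedAddCommGroup E] [InnerProductSpace ℝ E] [FiniteDimensional ℝ E]
variable {ν : ℝ} {f : ℝ → E → E} {u₀ : E → E}

/-- **Patching per-horizon solutions of a uniqueness class to `[0, ∞)`** (the «restart, identify on
the overlap, iterate» bookkeeping, Robinson–Rodrigo–Sadowski 2016 §8.1; Lemarié-Rieusset 2016,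
Thm. 7.2: «the maximal time is `+∞`»). Let `Q T U P` be any class of pairs on the closed slab
`[0, T]` such that (i) members are classical solutions (viscosity `ν`, force `f`) on `E × [0, T]` with
`U 0 = u₀` (`hQ`), (ii) for every `T > 0` the class is non-empty (`hex`), and (iii) two members, of
horizons `T₁`, `T₂`, have the same velocity at every common time (`huniq`). Then there is a classical
solution `(u, p)` on `E × [0, ∞)` with `u 0 = u₀`, `p(t, 0) = 0`, such that for every `T > 0` some
member `(U, P)` of the class with horizon `T' ≥ T` satisfies `u = U` and `p = P − P(·, 0)` on
`[0, T]` — every finite piece of the patched solution is one of the given ones, so any slice-wise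
side condition of the class (energy, Sobolev bounds, periodicity, …) is inherited. Construction:
`u(t) = U_{⌊t⌋₊}(t)` for chosen members `U_n` of horizon `n + 1`; `congr_slices`,
`sub_pressure_apply_zero`, `pressure_sub_apply_zero_eq_of_eqOn`, `of_forall_Ico_nat`.
[cite: RobinsonRodrigoSadowskiCUP2016, §8.1] [cite: LemarieRieusset2016, Thm. 7.2 (proof p. 147)] -/
theorem IsClassicalNSSolutionOn.exists_Ici_of_forall_Icc_of_unique
    (Q : ℝ → (ℝ → E → E) → (ℝ → E → ℝ) → Prop)
    (hQ : ∀ T U P, Q T U P → IsClassicalNSSolutionOn (Icc 0 T) ν f U P ∧ U 0 = u₀)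
    (hex : ∀ T : ℝ, 0 < T → ∃ (U : ℝ → E → E) (P : ℝ → E → ℝ), Q T U P)
    (huniq : ∀ (T₁ T₂ : ℝ) (U₁ : ℝ → E → E) (P₁ : ℝ → E → ℝ) (U₂ : ℝ → E → E) (P₂ : ℝ → E → ℝ),
      Q T₁ U₁ P₁ → Q T₂ U₂ P₂ → ∀ t ∈ Icc 0 T₁, t ≤ T₂ → U₁ t = U₂ t) :
    ∃ (u : ℝ → E → E) (p : ℝ → E → ℝ),
      IsClassicalNSSolutionOn (Ici 0) ν f u p ∧ u 0 = u₀ ∧ (∀ t, p t 0 = 0) ∧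
        ∀ T : ℝ, 0 < T → ∃ (T' : ℝ) (U : ℝ → E → E) (P : ℝ → E → ℝ), T ≤ T' ∧ Q T' U P ∧
          (∀ t ∈ Icc 0 T, u t = U t) ∧ ∀ t ∈ Icc 0 T, ∀ x, p t x = P t x - P t 0 := by
  classical
  have hn : ∀ n : ℕ, ∃ (U : ℝ → E → E) (P : ℝ → E → ℝ), Q ((n : ℝ) + 1) U P :=
    fun n => hex _ (by positivity)
  choose U P hUP using hn
  have hU : ∀ n : ℕ, IsClassicalNSSolutionOn (Icc 0 ((n : ℝ) + 1)) ν f (U n) (P n) :=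
    fun n => (hQ _ _ _ (hUP n)).1
  have hU0 : ∀ n : ℕ, U n 0 = u₀ := fun n => (hQ _ _ _ (hUP n)).2
  -- any two choices agree at common times
  have hagree : ∀ m n : ℕ, ∀ t ∈ Icc (0 : ℝ) ((m : ℝ) + 1), t ≤ (n : ℝ) + 1 → U m t = U n t :=
    fun m n t ht htn => huniq _ _ _ _ _ _ (hUP m) (hUP n) t ht htn
  have hmem : ∀ t : ℝ, 0 ≤ t → t ∈ Icc (0 : ℝ) ((⌊t⌋₊ : ℝ) + 1) := fun t ht =>
    ⟨ht, (Nat.lt_floor_add_one t).le⟩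
  -- the normalised pressures of the choice at `t` and of any longer choice agree at `t`
  have hpagree : ∀ (N : ℕ) (t : ℝ), 0 ≤ t → t ≤ (N : ℝ) + 1 → ∀ x,
      P ⌊t⌋₊ t x - P ⌊t⌋₊ t 0 = P N t x - P N t 0 := by
    intro N t ht0 htN x
    set m : ℝ := min ((⌊t⌋₊ : ℝ) + 1) ((N : ℝ) + 1) with hm
    have hm0 : 0 < m := lt_min (by positivity) (by positivity)
    have htm : t ∈ Icc 0 m := ⟨ht0, le_min (Nat.lt_floor_add_one t).le htN⟩
    have hS₁ : Icc 0 m ⊆ Icc 0 ((⌊t⌋₊ : ℝ) + 1) := Icc_subset_Icc_right (min_le_left _ _)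
    have hS₂ : Icc 0 m ⊆ Icc 0 ((N : ℝ) + 1) := Icc_subset_Icc_right (min_le_right _ _)
    have heq : ∀ s ∈ Icc 0 m, U ⌊t⌋₊ s = U N s := fun s hs =>
      hagree ⌊t⌋₊ N s (hS₁ hs) (hs.2.trans (min_le_right _ _))
    exact (hU ⌊t⌋₊).pressure_sub_apply_zero_eq_of_eqOn (hU N) hS₁ hS₂ htm
      (uniqueDiffOn_Icc hm0 t htm) heq x
  refine ⟨fun t => U ⌊t⌋₊ t, fun t x => P ⌊t⌋₊ t x - P ⌊t⌋₊ t 0, ?_, ?_, fun t => sub_self _, ?_⟩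
  · refine IsClassicalNSSolutionOn.of_forall_Ico_nat fun N => ?_
    have hN : IsClassicalNSSolutionOn (Ico 0 ((N : ℝ) + 1)) ν f (U N)
        (fun t x => P N t x - P N t 0) :=
      ((hU N).mono Ico_subset_Icc_self (uniqueDiffOn_Ico 0 _)).sub_pressure_apply_zero
    refine hN.congr_slices (fun t ht => hagree ⌊t⌋₊ N t (hmem t ht.1) ht.2.le) fun t ht => ?_
    funext x
    exact hpagree N t ht.1 ht.2.le x
  · show U ⌊(0 : ℝ)⌋₊ 0 = u₀
    rw [Nat.floor_zero]
    exact hU0 0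
  · intro T hT
    have hTN : T ≤ (⌈T⌉₊ : ℝ) + 1 := (Nat.le_ceil T).trans (le_add_of_nonneg_right zero_le_one)
    refine ⟨(⌈T⌉₊ : ℝ) + 1, U ⌈T⌉₊, P ⌈T⌉₊, hTN, hUP _, fun t ht => ?_, fun t ht x => ?_⟩
    · exact hagree ⌊t⌋₊ ⌈T⌉₊ t (hmem t ht.1) (ht.2.trans hTN)
    · exact hpagree ⌈T⌉₊ t ht.1 (ht.2.trans hTN) x

end Generic

end Literature.Analysis.FluidPDE

end

-- WHAT THIS IS NOT: not a claim about NS regularity or blow-up; not a claim about any author beyond the typed locator.
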